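/-
Copyright: the b2b-balaban T⁴-continuum CRUX team, row NE7b leaf lineage `t4-ne7b-formalise-leaf-06` (gen 160). Project licence.
-/
import Summits.QuantumFields.BalabanUV.T4Continuum.Spine.NE7b.AugmentedSectionFibreEquivalence
import Summits.QuantumFields.BalabanUV.T4Continuum.Spine.NE7b.OneShotChartSupOperator
import Summits.QuantumFields.BalabanUV.T4Continuum.Spine.NE7b.FibreInverseSupNorm
import Summits.QuantumFields.BalabanUV.T4Continuum.Spine.NE7b.FibreSupUniqueness

/-!
# THE AUGMENTED MAP OF THE GAUSSIAN SKELETON IS AN EQUIVALENCE `ℓ^∞(ℤ^d) ≃L ℓ^∞(ℤ^d) × ker Q′` WITH `‖T⁻¹ y‖_∞ ≤ N_∞‖y‖_∞`,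
# `N_∞ = C_∞ + A_G K_d(δ_u∕4)·(1 + C_∞)` — the `lp ∞` INSTANTIATION of `…AugmentedSectionFibreEquivalence` ((56)): `D = Q′` (block mean),
# `R = P∘A` (`A = Δ^η + aQ′*Q′`, `P = 1 − Q′*Q′`), section `H` = (48)'s operator, fibre inverse `Γ = (1 − HQ′)G′` = (51)'s, uniqueness =
# (52)'s Liouville statement: HSCR's chart letters `T`, `hN` for the free skeleton IN THE SUP CURRENCY, every side, `d ≥ 3`
# (row NE7b, node U5c; the OWNER's located item (57), FILING-CLAIM C-ne7bp1-g114-3, taken by leaf-06; [folklore] packaging BY NAME)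

Cell `pub-balaban`, sub-cell `t4`, spine estimate NE7b (`T4WeightBudget.RelWeightBound`; the cell's OWN estimate — NOT PRINTED in
[Bałaban 1983–89], NOT PROVED).  Crux-route work under `Spine/NE7b/` by a row leaf (`t4-ne7b-formalise-leaf-06` gen 160) under FREEZE
(0)'s crux-prover clause, on the row OWNER's word (`t4-ne7b-p1` g114: «the `lp ∞(ℤ^d)` INSTANTIATION of (56) on the Gaussian skeleton —
`D` = block average, `R = P_{ker D}∘A`, `H` = (48)'s operator, `Γ` = (51)'s fibre inverse, uniqueness = (52): `∃ T : ℓ^∞ ≃L ℓ^∞ × ker D`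
with `‖T⁻¹y‖_∞ ≤ N_∞‖y‖_∞`, `N_∞ = C_∞ + A·K_d(1 + C_∞)`»).  NOTHING of Bałaban's is named as a Lean object, valued or asserted; no
`T4Continuum/Support` leaf typed; no `def` (operators delivered as `∃ T, …` with their pointwise action DISPLAYED, (48)'s pattern); zero
`sorry`.  Imports (BY NAME): (56) `…AugmentedSectionFibreEquivalence` (`exists_aug_equiv_bound`), (48)
`…OneShotChartSupOperator` (`exists_clm_HBZd`, `abs_apply_le_norm`), (51) `…FibreInverseSupNorm` (`abs_blockAvg_le`, `sum_B_HBZd_of_bounded`,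
`sum_AX_HBZd`, `blockAvg_fibreInverse`, `sum_AX_fibreInverse`, `abs_fibreInverse_le`), (52) `…FibreSupUniqueness` (`abs_sum_AX_mul_le`,
`eq_zero_of_bounded_fibre_solution`), (49) `…BlockPropagatorSupNorm` (via (51)), the Literature columns `B6QGQLower276` (`X`, `blk`, `B`,
`mem_B`, `sum_B_const`, `AX`, `c0`), `B5Hk103ScalarZd` (`Gk`, `Kinv`, `nbhd`), `B5Hk165L2Zd` (`HBZd`); Mathlib `lp`, `LinearMap.mkContinuous`,
`ContinuousLinearMap.codRestrict`, `Submodule.subtypeL`.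

WHY (located).  HSCR (`…HardStepChartRadius.exists_branch_chart`, any complete `E`) reads the chart through `T : E ≃L F × K` and
`‖T⁻¹ y‖ ≤ N‖y‖`; (56) proved currency-free that a section, a fibre inverse and uniqueness give both with `N = C_H + C_Γ`.  The OWNER's sup
column typed the skeleton's data in the `ℓ^∞` currency of print's small-field regions (HRS) — (48) `C_∞ = cHs·K_d(δ_H)`, (51)
`A_G K_d(δ_u∕4)(1 + C_∞)`, (52) — and (51) ∕ (52) say «the identification of `(Q′, A, Γ)` with HSCR's abstract `(D, V″, T⁻¹)` on an `lp ∞`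
carrier is NOT typed … a leaf may socket it».  THIS FILE is that socket.  The choice `R := P∘A` INTO `ker Q′` makes (56)'s four identities
literal: `P` kills the block-constant multiplier `Q′*λ` of `AH` and of `AΓ` and is the identity on `ker Q′`.

WHAT IS PROVED ([folklore]; `ℓ^∞ := lp (fun _ : X d => ℝ) ∞`; `n : ℕ` = side − 1, `a > 0`):
* §1 **`exists_clm_of_letters`** (any index types): an action `op : (ι → ℝ) → κ → ℝ` ADDITIVE and HOMOGENEOUS on bounded data with
  `|op f p| ≤ C·R` for `|f| ≤ R` IS a `lp ∞ →L[ℝ] lp ∞` with that action and `‖T‖ ≤ C` ((48)'s `mkContinuous` construction, once); instances,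
  every `d`: **`exists_clm_blockAvg`** (`Q′`, `‖·‖ ≤ 1`), **`exists_clm_AX`** (`A`, `≤ c0·K_d(1)`, side-dependent, only boundedness used),
  **`exists_clm_fibreProj`** (`P`: `(Pf)(p) = f p − (Q′f)(blk p)`, `≤ 2`), **`exists_clm_Gop`** (`d ≥ 3`; `G′`, `≤ A_G K_d(δ_u∕4)`).
* §2 FOR ANY operators with these displayed actions: `blockAvg_fibreProj` (`Q′∘P = 0`), `fibreProj_of_blockConst`, `fibreProj_of_mem_ker`
  (`P = 1` on `ker Q′`), **`blockAvg_section`** (`Q′H = 1`; (51) `sum_B_HBZd_of_bounded`), **`fibreProj_AX_section`** (`P(A(Hw)) = 0`; (51)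
  `sum_AX_HBZd`), `fibreInverse_apply` (`Γκ` written out as in (51)), **`blockAvg_fibreInverse_op`** (`Q′Γ = 0`; (51) `blockAvg_fibreInverse`),
  **`fibreProj_AX_fibreInverse`** (`P(A(Γκ)) = κ` on `ker Q′`; (51) `sum_AX_fibreInverse`), **`eq_zero_of_blockAvg_fibreProj`** (`Q′h = 0 ∧
  P(Ah) = 0 ⇒ h = 0`; (52) `eq_zero_of_bounded_fibre_solution`).
* §3 **`exists_aug_equiv_sup`** (`d ≥ 3`): `∃ Dop Aop Pop` (actions displayed, `‖Dop‖ ≤ 1`, `‖Pop‖ ≤ 2`) `∃ Rop : ℓ^∞ →L Dop.ker` (`↑(Rop h) = Pop (Aop h)`)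
  `∃ T : ℓ^∞ ≃L[ℝ] ℓ^∞ × Dop.ker`, `T h = (Dop h, Rop h)`, `(T⁻¹(w, κ))(p) = (Hw)(p) + (Γκ)(p)` written out, and
  **`‖T⁻¹ y‖ ≤ (C_∞ + A_G K_d(δ_u∕4)(1 + C_∞))·‖y‖`**, `A_G = (cG0·cKL + cSplit)e^{2δ_u} + cFar e^{4δ_u}∕δ_u²` — (56) `exists_aug_equiv_bound`
  fed by §2 with `Γ := (1 − Hop∘Dop)∘Gop∘subtypeL`; the SAME `N_∞` for every side.
* §4 toy: §1 on the identity action.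

HONEST (what this is NOT).  Constants existential ∕ useless by value; worse, BY VALUE the pure-sup currency cannot carry the chart at small
sides — the pricing desk's located remark (PRICING-NE7b v130 §4 ∕ F775 (iii); NL-NE7b-2° ∕ -3°, leaf-03's torus certificates): at
`(d, M) = (4, 2)` any `N ≥ ‖H‖_{∞→∞} ≥ 2.4214 > 2 = M^{(d−2)∕2}`, at side 3 `≥ 3.0709 > 3`; the currency of record is the MIXED one
(`K_mix(2) ≤ 1.2418` certified, NC-NE7b-GAMMA-1), whose instance of (56) is the OWNER's ∕ (A3)'s call — NOT here.  Scalar `ℤ^d` skeleton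
(`U = 1`), not HRS's torus carrier, not the covariant operators; the inductive step in a non-Hilbert currency is not typed (HSIS is Hilbert);
NC-NE7b-α UNRULED.  BY-NAME EFFECT ON THE WALL: NONE.  NE7b NOT PRINTED ∕ NOT PROVED; spine PROVED 0∕9; rung (B)+1 on a FINITE torus —
NOT infinite volume, NOT the mass gap, NOT Clay.  HONEST DEPENDENCY: continuum YM on T⁴ ⇐ BetaPertH ∧ nine spine estimates (0∕9 proved);
BetaPertH ⇐ (D1) ∧ (D4) ∧ CAP+tail; G-an2-4 gates asym, D1 and NE2∕3∕4.
-/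

set_option autoImplicit false

namespace Summit.QuantumFields.BalabanUV.T4Continuum.NE7b.AugmentedSupEquivalence

open scoped ENNReal
open Finset
open Literature.MathematicalPhysics.QuantumFieldTheory.Balaban1983to89
open B4Sect5Proof (latticeConst latticeConst_nonneg)
open B6QGQLower276 (X blk B mem_B sum_B_const AX c0 c0_pos)
open B6QGQDecay237 (deltaU deltaU_pos)
open B5Hk103ScalarZd (Gk Kinv nbhd deltaH deltaH_pos)
open B5Hk165L2Zd (HBZd)
open Summit.QuantumFields.BalabanUV.Beta.D1BFx.BlockColumnSupNorm (cHs cHs_nonneg)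
open Summit.QuantumFields.BalabanUV.Beta.D1BFx.PointColumnSplit (cKL cG0 cSplit)
open Summit.QuantumFields.BalabanUV.Beta.D1BFx.PointColumnDecay (cFar)
open OneShotChartSupOperator (abs_apply_le_norm exists_clm_HBZd)
open BlockPropagatorSupNorm (summable_Gk_mul_of_bounded abs_tsum_Gk_mul_le_sup supConstG_nonneg)
open FibreInverseSupNorm (abs_blockAvg_le sum_B_HBZd_of_bounded sum_AX_HBZd blockAvg_fibreInverse sum_AX_fibreInverse abs_fibreInverse_le)
open FibreSupUniqueness (abs_sum_AX_mul_le eq_zero_of_bounded_fibre_solution)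
open AugmentedSectionFibreEquivalence (exists_aug_equiv_bound)

noncomputable section

variable {d : ℕ}

/-! ## §1. Bounded actions on bounded data are operators on `ℓ^∞`; the four operators of the skeleton -/

/-- **A BOUNDED ACTION ON BOUNDED DATA IS AN OPERATOR ON `lp ∞`**: if `op : (ι → ℝ) → κ → ℝ` is additive and homogeneous on bounded
data and `|op f p| ≤ C·R` whenever `|f| ≤ R`, then there is `T : lp ∞ →L[ℝ] lp ∞` with `T f p = op f p` and `‖T‖ ≤ C`. [folklore] -/
theorem exists_clm_of_letters {ι κ : Type*} (op : (ι → ℝ) → κ → ℝ)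
    (hadd : ∀ (f g : ι → ℝ) (Rf Rg : ℝ), (∀ i, |f i| ≤ Rf) → (∀ i, |g i| ≤ Rg) → ∀ p, op (f + g) p = op f p + op g p)
    (hsmul : ∀ (r : ℝ) (f : ι → ℝ) (R : ℝ), (∀ i, |f i| ≤ R) → ∀ p, op (r • f) p = r * op f p)
    {C : ℝ} (hC : 0 ≤ C) (hbd : ∀ (f : ι → ℝ) (R : ℝ), (∀ i, |f i| ≤ R) → ∀ p, |op f p| ≤ C * R) :
    ∃ T : lp (fun _ : ι => ℝ) ∞ →L[ℝ] lp (fun _ : κ => ℝ) ∞,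
      (∀ (f : lp (fun _ : ι => ℝ) ∞) (p : κ), T f p = op f p) ∧ ‖T‖ ≤ C := by
  have habs : ∀ (f : lp (fun _ : ι => ℝ) ∞) (i : ι), |f i| ≤ ‖f‖ := fun f i => by
    have h := lp.norm_apply_le_norm ENNReal.top_ne_zero f i
    rwa [Real.norm_eq_abs] at h
  have hmem : ∀ f : lp (fun _ : ι => ℝ) ∞, Memℓp (fun p => op f p) ∞ := fun f =>
    memℓp_infty ⟨C * ‖f‖, by
      rintro _ ⟨p, rfl⟩
      dsimp only
      rw [Real.norm_eq_abs]
      exact hbd _ _ (habs f) p⟩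
  let T₀ : lp (fun _ : ι => ℝ) ∞ → lp (fun _ : κ => ℝ) ∞ := fun f => ⟨fun p => op f p, hmem f⟩
  have happ : ∀ (f : lp (fun _ : ι => ℝ) ∞) (p : κ), T₀ f p = op f p := fun f p => rfl
  have hadd' : ∀ f g : lp (fun _ : ι => ℝ) ∞, T₀ (f + g) = T₀ f + T₀ g := by
    intro f g
    refine lp.ext (funext fun p => ?_)
    rw [lp.coeFn_add, Pi.add_apply, happ, happ, happ, lp.coeFn_add]
    exact hadd _ _ _ _ (habs f) (habs g) p
  have hsmul' : ∀ (r : ℝ) (f : lp (fun _ : ι => ℝ) ∞), T₀ (r • f) = r • T₀ f := by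
    intro r f
    refine lp.ext (funext fun p => ?_)
    rw [lp.coeFn_smul, Pi.smul_apply, happ, happ, lp.coeFn_smul, smul_eq_mul]
    exact hsmul r _ _ (habs f) p
  let Tl : lp (fun _ : ι => ℝ) ∞ →ₗ[ℝ] lp (fun _ : κ => ℝ) ∞ :=
    { toFun := T₀, map_add' := hadd', map_smul' := hsmul' }
  have hbd' : ∀ f : lp (fun _ : ι => ℝ) ∞, ‖Tl f‖ ≤ C * ‖f‖ := fun f =>
    lp.norm_le_of_forall_le (mul_nonneg hC (norm_nonneg _)) fun p => by
      change ‖op f p‖ ≤ _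
      rw [Real.norm_eq_abs]
      exact hbd _ _ (habs f) p
  exact ⟨Tl.mkContinuous _ hbd', fun f p => rfl, Tl.mkContinuous_norm_le hC hbd'⟩

/-- **THE BLOCK MEAN `Q′` IS AN OPERATOR ON `ℓ^∞(ℤ^d)` OF NORM `≤ 1`** (every `d`, every side). [folklore] -/
theorem exists_clm_blockAvg (n : ℕ) :
    ∃ T : lp (fun _ : X d => ℝ) ∞ →L[ℝ] lp (fun _ : X d => ℝ) ∞,
      (∀ (f : lp (fun _ : X d => ℝ) ∞) (y : X d), T f y = (((n : ℝ) + 1) ^ d)⁻¹ * ∑ p ∈ B n y, f p) ∧ ‖T‖ ≤ 1 := by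
  refine exists_clm_of_letters (fun f y => (((n : ℝ) + 1) ^ d)⁻¹ * ∑ p ∈ B n y, f p)
    (fun f g _ _ _ _ y => ?_) (fun r f _ _ y => ?_) zero_le_one (fun f R hf y => ?_)
  · simp only [Pi.add_apply, Finset.sum_add_distrib, mul_add]
  · simp only [Pi.smul_apply, smul_eq_mul, ← Finset.mul_sum]
    ring
  · rw [one_mul]
    exact abs_blockAvg_le n hf y

/-- **THE SITE OPERATOR `A = Δ^η + aQ′*Q′` IS AN OPERATOR ON `ℓ^∞(ℤ^d)`** (every `d`; finite rows): `(Af)(p) = Σ_{r∈nbhd p} A(p,r) f r`,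
`‖A‖ ≤ c0(d,n,a)·K_d(1)` (side-dependent; only boundedness is used). [folklore] -/
theorem exists_clm_AX (n : ℕ) {a : ℝ} (ha : 0 < a) :
    ∃ T : lp (fun _ : X d => ℝ) ∞ →L[ℝ] lp (fun _ : X d => ℝ) ∞,
      (∀ (f : lp (fun _ : X d => ℝ) ∞) (p : X d), T f p = ∑ r ∈ nbhd n p, AX n a p r * f r) ∧
        ‖T‖ ≤ c0 d n a * latticeConst d 1 := by
  refine exists_clm_of_letters (fun f p => ∑ r ∈ nbhd n p, AX n a p r * f r)
    (fun f g _ _ _ _ p => ?_) (fun r f _ _ p => ?_)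
    (mul_nonneg (c0_pos d n ha.ne').le (latticeConst_nonneg d zero_le_one)) (fun f R hf p => abs_sum_AX_mul_le n ha hf p)
  · simp only [Pi.add_apply, mul_add, Finset.sum_add_distrib]
  · simp only [Pi.smul_apply, smul_eq_mul, Finset.mul_sum]
    exact Finset.sum_congr rfl fun r _ => by ring

/-- **THE FIBRE PROJECTION `P = 1 − Q′*Q′` IS AN OPERATOR ON `ℓ^∞(ℤ^d)` OF NORM `≤ 2`** (every `d`): `(Pf)(p) = f p − (Q′f)(blk p)`.
[folklore] -/
theorem exists_clm_fibreProj (n : ℕ) :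
    ∃ T : lp (fun _ : X d => ℝ) ∞ →L[ℝ] lp (fun _ : X d => ℝ) ∞,
      (∀ (f : lp (fun _ : X d => ℝ) ∞) (p : X d), T f p = f p - (((n : ℝ) + 1) ^ d)⁻¹ * ∑ p' ∈ B n (blk n p), f p') ∧ ‖T‖ ≤ 2 := by
  refine exists_clm_of_letters (fun f p => f p - (((n : ℝ) + 1) ^ d)⁻¹ * ∑ p' ∈ B n (blk n p), f p')
    (fun f g _ _ _ _ p => ?_) (fun r f _ _ p => ?_) zero_le_two (fun f R hf p => ?_)
  · simp only [Pi.add_apply, Finset.sum_add_distrib, mul_add]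
    ring
  · simp only [Pi.smul_apply, smul_eq_mul, ← Finset.mul_sum]
    ring
  · calc _ ≤ |f p| + |(((n : ℝ) + 1) ^ d)⁻¹ * ∑ p' ∈ B n (blk n p), f p'| := abs_sub _ _
      _ ≤ R + R := add_le_add (hf p) (abs_blockAvg_le n hf (blk n p))
      _ = 2 * R := by ring

/-- **THE MASSIVE BLOCK PROPAGATOR `G′` IS AN OPERATOR ON `ℓ^∞(ℤ^d)`** (`d ≥ 3`): `(G′f)(p) = Σ′_q G′(p,q) f q`,
`‖G′‖ ≤ A_G(d,a)·K_d(δ_u∕4)` uniformly in the side — (49)'s letter as an operator norm. [folklore] -/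
theorem exists_clm_Gop (hd : 3 ≤ d) (n : ℕ) {a : ℝ} (ha : 0 < a) :
    ∃ T : lp (fun _ : X d => ℝ) ∞ →L[ℝ] lp (fun _ : X d => ℝ) ∞,
      (∀ (f : lp (fun _ : X d => ℝ) ∞) (p : X d), T f p = ∑' q : X d, Gk n a p q * f q) ∧
        ‖T‖ ≤ ((cG0 d * cKL d (d - 2) + cSplit d a) * Real.exp (2 * deltaU d a)
            + cFar d a * Real.exp (4 * deltaU d a) / deltaU d a ^ 2) * latticeConst d (deltaU d a / 4) := by
  refine exists_clm_of_letters (fun f p => ∑' q : X d, Gk n a p q * f q)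
    (fun f g Rf Rg hf hg p => ?_) (fun r f R hf p => ?_)
    (mul_nonneg (supConstG_nonneg d ha) (latticeConst_nonneg d (div_nonneg (deltaU_pos d ha).le zero_le_four)))
    fun f R hf p => abs_tsum_Gk_mul_le_sup hd n ha hf p
  · rw [← (summable_Gk_mul_of_bounded n ha hf p).tsum_add (summable_Gk_mul_of_bounded n ha hg p)]
    exact tsum_congr fun q => by rw [Pi.add_apply]; ring
  · rw [← tsum_mul_left]
    exact tsum_congr fun q => by rw [Pi.smul_apply, smul_eq_mul]; ring

/-! ## §2. The four identities and uniqueness, for any operators with the displayed actions -/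

section Identities

variable {n : ℕ} {a : ℝ} {Dop Aop Pop Gop Hop : lp (fun _ : X d => ℝ) ∞ →L[ℝ] lp (fun _ : X d => ℝ) ∞}

/-- `Q′ ∘ P = 0`: the projection lands in `ker Q′` (every `d`). [folklore] -/
theorem blockAvg_fibreProj
    (hD : ∀ (f : lp (fun _ : X d => ℝ) ∞) (y : X d), Dop f y = (((n : ℝ) + 1) ^ d)⁻¹ * ∑ p ∈ B n y, f p)
    (hP : ∀ (f : lp (fun _ : X d => ℝ) ∞) (p : X d), Pop f p = f p - (((n : ℝ) + 1) ^ d)⁻¹ * ∑ p' ∈ B n (blk n p), f p')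
    (f : lp (fun _ : X d => ℝ) ∞) : Dop (Pop f) = 0 := by
  have hsd : (0 : ℝ) < ((n : ℝ) + 1) ^ d := by positivity
  refine lp.ext (funext fun y => ?_)
  rw [lp.coeFn_zero, Pi.zero_apply, hD]
  have hs : ∑ p ∈ B n y, Pop f p
      = ∑ p ∈ B n y, f p - ∑ _p ∈ B n y, (((n : ℝ) + 1) ^ d)⁻¹ * ∑ p' ∈ B n y, f p' := by
    rw [← Finset.sum_sub_distrib]
    exact Finset.sum_congr rfl fun p hp => by rw [hP, mem_B.1 hp]
  rw [hs, sum_B_const, ← mul_assoc, mul_inv_cancel₀ hsd.ne', one_mul, sub_self, mul_zero]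

/-- `P` KILLS BLOCK-CONSTANT FIELDS (every `d`): if `f p = c (blk p)` for all `p` then `P f = 0`. [folklore] -/
theorem fibreProj_of_blockConst
    (hP : ∀ (f : lp (fun _ : X d => ℝ) ∞) (p : X d), Pop f p = f p - (((n : ℝ) + 1) ^ d)⁻¹ * ∑ p' ∈ B n (blk n p), f p')
    (f : lp (fun _ : X d => ℝ) ∞) (c : X d → ℝ) (hf : ∀ p, f p = c (blk n p)) : Pop f = 0 := by
  have hsd : (0 : ℝ) < ((n : ℝ) + 1) ^ d := by positivity
  refine lp.ext (funext fun p => ?_)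
  rw [lp.coeFn_zero, Pi.zero_apply, hP, hf]
  have hs : ∑ p' ∈ B n (blk n p), f p' = ∑ _p' ∈ B n (blk n p), c (blk n p) :=
    Finset.sum_congr rfl fun p' hp' => by rw [hf, mem_B.1 hp']
  rw [hs, sum_B_const, ← mul_assoc, inv_mul_cancel₀ hsd.ne', one_mul, sub_self]

/-- `P = 1` ON `ker Q′` (every `d`). [folklore] -/
theorem fibreProj_of_mem_ker
    (hD : ∀ (f : lp (fun _ : X d => ℝ) ∞) (y : X d), Dop f y = (((n : ℝ) + 1) ^ d)⁻¹ * ∑ p ∈ B n y, f p)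
    (hP : ∀ (f : lp (fun _ : X d => ℝ) ∞) (p : X d), Pop f p = f p - (((n : ℝ) + 1) ^ d)⁻¹ * ∑ p' ∈ B n (blk n p), f p')
    (κ : lp (fun _ : X d => ℝ) ∞) (hκ : Dop κ = 0) : Pop κ = κ := by
  refine lp.ext (funext fun p => ?_)
  rw [hP, ← hD κ (blk n p), hκ, lp.coeFn_zero, Pi.zero_apply, sub_zero]

/-- **`Q′ H = 1` ON `ℓ^∞`** (every `d`): `Dop (Hop w) = w` — (51) `sum_B_HBZd_of_bounded`. [folklore] -/
theorem blockAvg_section (ha : 0 < a)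
    (hD : ∀ (f : lp (fun _ : X d => ℝ) ∞) (y : X d), Dop f y = (((n : ℝ) + 1) ^ d)⁻¹ * ∑ p ∈ B n y, f p)
    (hH : ∀ (w : lp (fun _ : X d => ℝ) ∞) (p : X d), Hop w p = HBZd n a w p)
    (w : lp (fun _ : X d => ℝ) ∞) : Dop (Hop w) = w := by
  have hsd : (0 : ℝ) < ((n : ℝ) + 1) ^ d := by positivity
  refine lp.ext (funext fun y => ?_)
  rw [hD, Finset.sum_congr rfl fun p _ => hH w p, sum_B_HBZd_of_bounded n ha (abs_apply_le_norm w) y, ← mul_assoc,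
    inv_mul_cancel₀ hsd.ne', one_mul]

/-- **THE SECTION IS `R`-CRITICAL: `P (A (H w)) = 0`** (every `d`) — `A(Hw)(p) = Σ′_y w(y)(Q′G′Q′*)⁻¹(blk p, y)` is block-constant ((51)
`sum_AX_HBZd`) and `P` kills block-constants. [folklore] -/
theorem fibreProj_AX_section (ha : 0 < a)
    (hA : ∀ (f : lp (fun _ : X d => ℝ) ∞) (p : X d), Aop f p = ∑ r ∈ nbhd n p, AX n a p r * f r)
    (hP : ∀ (f : lp (fun _ : X d => ℝ) ∞) (p : X d), Pop f p = f p - (((n : ℝ) + 1) ^ d)⁻¹ * ∑ p' ∈ B n (blk n p), f p')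
    (hH : ∀ (w : lp (fun _ : X d => ℝ) ∞) (p : X d), Hop w p = HBZd n a w p)
    (w : lp (fun _ : X d => ℝ) ∞) : Pop (Aop (Hop w)) = 0 :=
  fibreProj_of_blockConst hP _ (fun y => ∑' y' : X d, w y' * Kinv n a y y') fun p => by
    rw [hA, Finset.sum_congr rfl fun r _ => by rw [hH w r], sum_AX_HBZd n ha (abs_apply_le_norm w) p]

/-- **THE FIBRE INVERSE, WRITTEN OUT**: `(Gop κ − Hop (Dop (Gop κ)))(p) = (G′κ)(p) − (H(Q′G′κ))(p)` in (51)'s spelling. [folklore] -/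
theorem fibreInverse_apply
    (hD : ∀ (f : lp (fun _ : X d => ℝ) ∞) (y : X d), Dop f y = (((n : ℝ) + 1) ^ d)⁻¹ * ∑ p ∈ B n y, f p)
    (hG : ∀ (f : lp (fun _ : X d => ℝ) ∞) (p : X d), Gop f p = ∑' q : X d, Gk n a p q * f q)
    (hH : ∀ (w : lp (fun _ : X d => ℝ) ∞) (p : X d), Hop w p = HBZd n a w p)
    (κ : lp (fun _ : X d => ℝ) ∞) (p : X d) :
    (Gop κ - Hop (Dop (Gop κ))) p
      = (∑' q : X d, Gk n a p q * κ q)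
        - HBZd n a (fun y => (((n : ℝ) + 1) ^ d)⁻¹ * ∑ p' ∈ B n y, ∑' q : X d, Gk n a p' q * κ q) p := by
  have hQG : ⇑(Dop (Gop κ)) = fun y => (((n : ℝ) + 1) ^ d)⁻¹ * ∑ p' ∈ B n y, ∑' q : X d, Gk n a p' q * κ q :=
    funext fun y => by rw [hD]; exact congrArg _ (Finset.sum_congr rfl fun p' _ => hG κ p')
  rw [lp.coeFn_sub, Pi.sub_apply, hG, hH, hQG]

/-- **`Q′ Γ = 0`** (every `d`): `Dop (Gop κ − Hop (Dop (Gop κ))) = 0` — (51) `blockAvg_fibreInverse` (the rows of `G′κ` are bounded by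
`‖Gop κ‖`). [folklore] -/
theorem blockAvg_fibreInverse_op (ha : 0 < a)
    (hD : ∀ (f : lp (fun _ : X d => ℝ) ∞) (y : X d), Dop f y = (((n : ℝ) + 1) ^ d)⁻¹ * ∑ p ∈ B n y, f p)
    (hG : ∀ (f : lp (fun _ : X d => ℝ) ∞) (p : X d), Gop f p = ∑' q : X d, Gk n a p q * f q)
    (hH : ∀ (w : lp (fun _ : X d => ℝ) ∞) (p : X d), Hop w p = HBZd n a w p)
    (κ : lp (fun _ : X d => ℝ) ∞) : Dop (Gop κ - Hop (Dop (Gop κ))) = 0 := by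
  have hGb : ∀ p, |∑' q : X d, Gk n a p q * κ q| ≤ ‖Gop κ‖ := fun p => by
    rw [← hG]; exact abs_apply_le_norm _ p
  refine lp.ext (funext fun y => ?_)
  rw [lp.coeFn_zero, Pi.zero_apply, hD, Finset.sum_congr rfl fun p _ => fibreInverse_apply hD hG hH κ p]
  exact blockAvg_fibreInverse n ha hGb y

/-- **`R Γ = 1` ON THE FIBRE**: for `Q′κ = 0`, `Pop (Aop (Gop κ − Hop (Dop (Gop κ)))) = κ` — `A(Γκ) = κ − Q′*λ` ((51) `sum_AX_fibreInverse`),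
`P` kills the multiplier and is the identity on `ker Q′`. [folklore] -/
theorem fibreProj_AX_fibreInverse (ha : 0 < a)
    (hD : ∀ (f : lp (fun _ : X d => ℝ) ∞) (y : X d), Dop f y = (((n : ℝ) + 1) ^ d)⁻¹ * ∑ p ∈ B n y, f p)
    (hA : ∀ (f : lp (fun _ : X d => ℝ) ∞) (p : X d), Aop f p = ∑ r ∈ nbhd n p, AX n a p r * f r)
    (hP : ∀ (f : lp (fun _ : X d => ℝ) ∞) (p : X d), Pop f p = f p - (((n : ℝ) + 1) ^ d)⁻¹ * ∑ p' ∈ B n (blk n p), f p')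
    (hG : ∀ (f : lp (fun _ : X d => ℝ) ∞) (p : X d), Gop f p = ∑' q : X d, Gk n a p q * f q)
    (hH : ∀ (w : lp (fun _ : X d => ℝ) ∞) (p : X d), Hop w p = HBZd n a w p)
    (κ : lp (fun _ : X d => ℝ) ∞) (hκ : Dop κ = 0) :
    Pop (Aop (Gop κ - Hop (Dop (Gop κ)))) = κ := by
  have hsd : (0 : ℝ) < ((n : ℝ) + 1) ^ d := by positivity
  have hκb : ∀ q, |κ q| ≤ ‖κ‖ := abs_apply_le_norm κ
  have hGb : ∀ p, |∑' q : X d, Gk n a p q * κ q| ≤ ‖Gop κ‖ := fun p => by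
    rw [← hG]; exact abs_apply_le_norm _ p
  -- `A(Γκ)(p) = κ p − λ(blk p)` with the block-constant multiplier `λ`
  have hAΓ : ∀ p, Aop (Gop κ - Hop (Dop (Gop κ))) p
      = κ p - ∑' y : X d, ((((n : ℝ) + 1) ^ d)⁻¹ * ∑ p' ∈ B n y, ∑' q : X d, Gk n a p' q * κ q)
          * Kinv n a (blk n p) y := fun p => by
    rw [hA, Finset.sum_congr rfl fun r _ => by rw [fibreInverse_apply hD hG hH κ r]]
    exact sum_AX_fibreInverse n ha hκb hGb p
  -- `Q′κ = 0` pointwise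
  have hQκ : ∀ y, (((n : ℝ) + 1) ^ d)⁻¹ * ∑ p' ∈ B n y, κ p' = 0 := fun y => by
    rw [← hD κ y, hκ, lp.coeFn_zero, Pi.zero_apply]
  refine lp.ext (funext fun p => ?_)
  rw [hP, hAΓ, Finset.sum_congr rfl fun p' (hp' : p' ∈ B n (blk n p)) => by rw [hAΓ, mem_B.1 hp'],
    Finset.sum_sub_distrib, sum_B_const, mul_sub, hQκ, ← mul_assoc, inv_mul_cancel₀ hsd.ne', one_mul]
  ring

/-- **UNIQUENESS ON `ℓ^∞`**: `Dop h = 0` and `Pop (Aop h) = 0` imply `h = 0` — `P(Ah) = 0` says `Ah` is block-constant (`= Q′(Ah) ∘ blk`),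
`Q′h = 0` says the block sums vanish, and (52) `eq_zero_of_bounded_fibre_solution` is Liouville for exactly that system (every `d`). [folklore] -/
theorem eq_zero_of_blockAvg_fibreProj (ha : 0 < a)
    (hD : ∀ (f : lp (fun _ : X d => ℝ) ∞) (y : X d), Dop f y = (((n : ℝ) + 1) ^ d)⁻¹ * ∑ p ∈ B n y, f p)
    (hA : ∀ (f : lp (fun _ : X d => ℝ) ∞) (p : X d), Aop f p = ∑ r ∈ nbhd n p, AX n a p r * f r)
    (hP : ∀ (f : lp (fun _ : X d => ℝ) ∞) (p : X d), Pop f p = f p - (((n : ℝ) + 1) ^ d)⁻¹ * ∑ p' ∈ B n (blk n p), f p')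
    (h : lp (fun _ : X d => ℝ) ∞) (h1 : Dop h = 0) (h2 : Pop (Aop h) = 0) : h = 0 := by
  have hsd : (0 : ℝ) < ((n : ℝ) + 1) ^ d := by positivity
  -- `Ah` is block-constant, with value its own block mean
  have hAc : ∀ p : X d, ∑ r ∈ nbhd n p, AX n a p r * h r = (fun y => Dop (Aop h) y) (blk n p) := fun p => by
    have e := congrArg (fun f : lp (fun _ : X d => ℝ) ∞ => f p) h2
    dsimp only at e
    rw [hP, lp.coeFn_zero, Pi.zero_apply, sub_eq_zero, hA] at e
    dsimp only
    rw [hD, e]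
  -- the block sums of `h` vanish
  have hQ : ∀ z : X d, ∑ p ∈ B n z, h p = 0 := fun z => by
    have e := congrArg (fun f : lp (fun _ : X d => ℝ) ∞ => f z) h1
    dsimp only at e
    rw [hD, lp.coeFn_zero, Pi.zero_apply, mul_eq_zero] at e
    exact e.resolve_left (inv_ne_zero hsd.ne')
  exact lp.ext (funext fun p => eq_zero_of_bounded_fibre_solution n ha (abs_apply_le_norm h) hAc hQ p)

end Identities

/-! ## §3. The equivalence `ℓ^∞ ≃L ℓ^∞ × ker Q′` with `‖T⁻¹ y‖ ≤ N_∞‖y‖` -/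
set_option maxHeartbeats 400000 in
/-- **THE AUGMENTED MAP OF THE GAUSSIAN SKELETON IS AN EQUIVALENCE ON `ℓ^∞(ℤ^d)` (`d ≥ 3`) WITH A MESH-UNIFORM INVERSE BOUND**:
`Dop = Q′`, `Aop = A`, `Pop = 1 − Q′*Q′` (actions displayed), `Rop := Pop∘Aop` into `ker Dop`, `T h = (Dop h, Rop h)`, `T⁻¹(w, κ) = Hw + Γκ`
written out, `‖T⁻¹ y‖ ≤ (C_∞ + A_G K_d(δ_u∕4)(1 + C_∞))·‖y‖` — HSCR's `T`, `hT`, `hN`, the SAME `N_∞` for every side; (56) fed by §2. [folklore] -/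
theorem exists_aug_equiv_sup (hd : 3 ≤ d) (n : ℕ) {a : ℝ} (ha : 0 < a) :
    ∃ (Dop Aop Pop : lp (fun _ : X d => ℝ) ∞ →L[ℝ] lp (fun _ : X d => ℝ) ∞),
      (∀ (f : lp (fun _ : X d => ℝ) ∞) (y : X d), Dop f y = (((n : ℝ) + 1) ^ d)⁻¹ * ∑ p ∈ B n y, f p) ∧
      (∀ (f : lp (fun _ : X d => ℝ) ∞) (p : X d), Aop f p = ∑ r ∈ nbhd n p, AX n a p r * f r) ∧
      (∀ (f : lp (fun _ : X d => ℝ) ∞) (p : X d), Pop f p = f p - (((n : ℝ) + 1) ^ d)⁻¹ * ∑ p' ∈ B n (blk n p), f p') ∧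
      ‖Dop‖ ≤ 1 ∧ ‖Pop‖ ≤ 2 ∧
      ∃ Rop : lp (fun _ : X d => ℝ) ∞ →L[ℝ] Dop.ker,
        (∀ h, (Rop h : lp (fun _ : X d => ℝ) ∞) = Pop (Aop h)) ∧
        ∃ T : lp (fun _ : X d => ℝ) ∞ ≃L[ℝ] (lp (fun _ : X d => ℝ) ∞) × Dop.ker,
          (∀ h, T h = (Dop h, Rop h)) ∧
          (∀ (w : lp (fun _ : X d => ℝ) ∞) (κ : Dop.ker) (p : X d),
            (T.symm (w, κ) : lp (fun _ : X d => ℝ) ∞) p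
              = HBZd n a w p
                + ((∑' q : X d, Gk n a p q * (κ : lp (fun _ : X d => ℝ) ∞) q)
                  - HBZd n a (fun y => (((n : ℝ) + 1) ^ d)⁻¹ * ∑ p' ∈ B n y,
                      ∑' q : X d, Gk n a p' q * (κ : lp (fun _ : X d => ℝ) ∞) q) p)) ∧
          ∀ y, ‖T.symm y‖
            ≤ (cHs d a * latticeConst d (deltaH d a)
                + ((cG0 d * cKL d (d - 2) + cSplit d a) * Real.exp (2 * deltaU d a)
                    + cFar d a * Real.exp (4 * deltaU d a) / deltaU d a ^ 2) * latticeConst d (deltaU d a / 4)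
                  * (1 + cHs d a * latticeConst d (deltaH d a))) * ‖y‖ := by
  obtain ⟨Dop, hD, hDn⟩ := exists_clm_blockAvg (d := d) n
  obtain ⟨Aop, hA, -⟩ := exists_clm_AX (d := d) n ha
  obtain ⟨Pop, hP, hPn⟩ := exists_clm_fibreProj (d := d) n
  obtain ⟨Gop, hG, -⟩ := exists_clm_Gop hd n ha
  obtain ⟨Hop, hH, hHn⟩ := exists_clm_HBZd hd n ha
  have hCH0 : 0 ≤ cHs d a * latticeConst d (deltaH d a) :=
    mul_nonneg (cHs_nonneg d ha) (latticeConst_nonneg d (deltaH_pos d ha).le)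
  have hCΓ0 : 0 ≤ ((cG0 d * cKL d (d - 2) + cSplit d a) * Real.exp (2 * deltaU d a)
      + cFar d a * Real.exp (4 * deltaU d a) / deltaU d a ^ 2) * latticeConst d (deltaU d a / 4)
        * (1 + cHs d a * latticeConst d (deltaH d a)) :=
    mul_nonneg (mul_nonneg (supConstG_nonneg d ha) (latticeConst_nonneg d (div_nonneg (deltaU_pos d ha).le zero_le_four)))
      (by linarith)
  -- `R := P∘A` into `ker Q′` and `Γ := (1 − HQ′)G′` on `ker Q′`, sealed behind their actions; then (56)'s five hypotheses and two letters
  have hRmem : ∀ h, (Pop.comp Aop) h ∈ Dop.ker := fun h => LinearMap.mem_ker.2 (blockAvg_fibreProj hD hP (Aop h))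
  obtain ⟨Rop, hRapp⟩ : ∃ Rop : lp (fun _ : X d => ℝ) ∞ →L[ℝ] Dop.ker, ∀ h, (Rop h : lp (fun _ : X d => ℝ) ∞) = Pop (Aop h) :=
    ⟨(Pop.comp Aop).codRestrict (Dop.ker) hRmem, fun h => rfl⟩
  obtain ⟨Γop, hΓapp⟩ : ∃ Γop : Dop.ker →L[ℝ] lp (fun _ : X d => ℝ) ∞,
      ∀ κ : Dop.ker, Γop κ = Gop (κ : lp (fun _ : X d => ℝ) ∞) - Hop (Dop (Gop (κ : lp (fun _ : X d => ℝ) ∞))) :=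
    ⟨((ContinuousLinearMap.id ℝ _ - Hop.comp Dop).comp Gop).comp (Dop.ker).subtypeL, fun κ => rfl⟩
  have hDH : ∀ w, Dop (Hop w) = w := blockAvg_section ha hD hH
  have hRH : ∀ w, Rop (Hop w) = 0 := fun w =>
    Subtype.ext (by rw [hRapp, ZeroMemClass.coe_zero]; exact fibreProj_AX_section ha hA hP hH w)
  have hDΓ : ∀ κ, Dop (Γop κ) = 0 := fun κ => by rw [hΓapp]; exact blockAvg_fibreInverse_op ha hD hG hH _
  have hRΓ : ∀ κ, Rop (Γop κ) = κ := fun κ =>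
    Subtype.ext (by rw [hRapp, hΓapp]; exact fibreProj_AX_fibreInverse ha hD hA hP hG hH _ (LinearMap.mem_ker.1 κ.2))
  have hU : ∀ h, Dop h = 0 → Rop h = 0 → h = 0 := fun h h1 h2 =>
    eq_zero_of_blockAvg_fibreProj ha hD hA hP h h1 (by rw [← hRapp, h2, ZeroMemClass.coe_zero])
  have hHb : ∀ w, ‖Hop w‖ ≤ cHs d a * latticeConst d (deltaH d a) * ‖w‖ := fun w =>
    (Hop.le_opNorm w).trans (mul_le_mul_of_nonneg_right hHn (norm_nonneg _))
  have hΓb : ∀ κ : Dop.ker, ‖Γop κ‖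
      ≤ ((cG0 d * cKL d (d - 2) + cSplit d a) * Real.exp (2 * deltaU d a)
          + cFar d a * Real.exp (4 * deltaU d a) / deltaU d a ^ 2) * latticeConst d (deltaU d a / 4)
        * (1 + cHs d a * latticeConst d (deltaH d a)) * ‖κ‖ := fun κ => by
    have hκb : ∀ q, |(κ : lp (fun _ : X d => ℝ) ∞) q| ≤ ‖κ‖ := fun q => by rw [Submodule.coe_norm]; exact abs_apply_le_norm _ q
    refine lp.norm_le_of_forall_le (mul_nonneg hCΓ0 (norm_nonneg _)) fun p => ?_
    rw [Real.norm_eq_abs, hΓapp, fibreInverse_apply hD hG hH]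
    exact abs_fibreInverse_le hd n ha hκb p
  obtain ⟨T, hT, hsymm, hN⟩ :=
    exists_aug_equiv_bound (D := Dop) (R := Rop) (H := Hop) (Γ := Γop) hDH hRH hDΓ hRΓ hU hCH0 hCΓ0 hHb hΓb
  refine ⟨Dop, Aop, Pop, hD, hA, hP, hDn, hPn, Rop, hRapp, T, hT, fun w κ p => ?_, fun y => ?_⟩
  · rw [hsymm, lp.coeFn_add, Pi.add_apply, hH, hΓapp, fibreInverse_apply hD hG hH]
  · exact hN y

/-! ## §4. Toy -/

/-- Toy: §1 on the identity action — additive, homogeneous, `|f p| ≤ 1·R`: an operator of norm `≤ 1` acting as the identity. -/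
example {ι : Type*} : ∃ T : lp (fun _ : ι => ℝ) ∞ →L[ℝ] lp (fun _ : ι => ℝ) ∞,
    (∀ (f : lp (fun _ : ι => ℝ) ∞) (p : ι), T f p = f p) ∧ ‖T‖ ≤ 1 :=
  exists_clm_of_letters (fun f p => f p) (fun _ _ _ _ _ _ _ => rfl) (fun _ _ _ _ _ => rfl) zero_le_one fun _ _ hf p => (hf p).trans_eq (one_mul _).symm

end

end Summit.QuantumFields.BalabanUV.T4Continuum.NE7b.AugmentedSupEquivalence
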